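import Literature.NumberTheory.EllipticCurves.SkinnerUrban2014.ShapiroSelmerBigRep
import Literature.NumberTheory.EllipticCurves.BigRepModuleShapiroH1EquivProofs
import Literature.NumberTheory.EllipticCurves.BigRepModuleShapiroEquivariantProofs
import Literature.NumberTheory.EllipticCurves.BigRepModuleShapiroSelmerConditionsProofs
import Literature.NumberTheory.EllipticCurves.IwasawaSelmerDualUniquenessProofs
import HarnessLib

/-!
# Skinner–Urban 2014, Prop. 3.2.3 (Shapiro's lemma for Selmer groups), anticyclotomic BDP/Greenberg
# conditions of Castella 2018, Def. 2.2 — the `Λ`-linear duality and the DISCHARGE of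
# `SkinnerUrban2014.prop323_XAc_equiv_XBigDecomp`

Topic `Literature/NumberTheory/EllipticCurves`. Theorems only: no definition, no named fact, no
`sorry`, no instance, no notation. Cell `bsd-stepL`, seat `bsd-stepL-defn-ty1` (g7): module M5b and
the assembly of the tree-mapped discharge plan `NOTE-prop323-Shapiro-discharge-plan-imc-p1-g11` (modules
M1, M2a/b, M3a/b, M4, M5a by `bsd-stepL-imc-p1` g11; M3 local/Selmer conditions p533709, p536693).

## The printed proof and its tree map

[SU14, Prop. 3.2.3, proof, pp. 21–22]: "`H¹(F_∞, T ⊗_A A^*) = lim→_n H¹(F_n, T ⊗_A A^*) =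
lim→_n H¹(F, Hom_ℤ(ℤ[Gal(F_n/F)], T ⊗_A A^*)) = … = H¹(F, T ⊗_A Λ^*_{F,A}(ε_F⁻¹))`. That this
identifies `Sel^Σ_{F_∞}(T)` with `Sel^Σ_F(T ⊗_A Λ_{F,A}(ε_F⁻¹))` then follows from the analysis in
3.1.2." — on the tree's co-induced model `M = BigRepModule ℤ_p p A`, `A = E[p^∞]`
(`AnticyclotomicBigGaloisRep κ ρ`, `ρ = primaryTorsionGaloisRep`):

1. Shapiro's bijection `H¹(Γ_K, M) ≃+ H¹(ker κ, A)`, `[c] ↦ [h ↦ c(h)(0)]`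
   (`BigRepModule.exists_addEquiv_h1_shapiro`, M5a);
2. it matches Castella's local conditions (Def. 2.2) on both sides
   (`BigGaloisRep.oneCocycleClass_mem_selmerBigDecomp_iff`, M3c = "the analysis in 3.1.2");
3. it intertwines `1 + T` on `H¹(Γ_K, M)` with `conj_γ` on `H¹(ker κ, A)` for `κ γ = 1`
   (`BigRepModule.conj_apply_zero_eq_one_add_X_smul`, M4: the conjugate of the Shapiro cocycle is the
   Shapiro image of `(1+T)·c` up to the coboundary of `c(γ)(1)`) — "`1 + T ↦ γ`" [Cas18, §2.2];
4. hence the Pontryagin duals are isomorphic `Λ = ℤ_p⟦T⟧`-modules: the `Λ`-action on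
   `X_ac = Hom(Sel_𝔭^Σ(K_∞), ℚ/ℤ)` is the one FORCED by `T ↦ conj_γ − 1` and `ℤ_p → ℤ/p^k`
   (`IwasawaDual.IsLocNil.module`, [GreenbergLNM1716, §1]), and transporting the `Λ`-action of
   `X^Σ = Sel^Σ(K, M)^∨` (Mathlib `CharacterModule`) along the dual of the bijection gives exactly that
   action (`IwasawaDual.IsLocNil.map_smul_eq_smulFun`, the abstract form of the tree's
   `SelmerDualData.toDual_smul`).

## Main statements

* `IwasawaDual.IsLocNil.map_smul_eq_smulFun` — FORCING LEMMA: an additive map `T : X' → Hom(S, A)`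
  out of a `ℤ_p⟦T⟧`-module with `T(X·x)(s) = T(x)(ψ s)` and `T(C c·x)(s) = (c mod p^k)·T(x)(s)`
  (`p^k s = 0`) is `ℤ_p⟦T⟧`-linear for the `IsLocNil.module` structure of `ψ`.
* `PowerSeries.C_smul_eq_val_smul_of_pow_smul_eq_zero` — in any `ℤ_p⟦T⟧`-module, constants act on
  `p^k`-torsion elements through `ℤ_p → ℤ/p^k`.
* `exists_subgroupH1_addEquiv_of_discrete` — `H¹(H, M)`, `conj_σ` and Castella's `Sel_𝔭^Σ` do not
  depend on WHICH discrete-topology instance `M` carries (the type synonym `PrimaryTorsion (geomPoints W) p`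
  carries `⊥`, the subgroup `W.geomPrimaryTorsion p` the subspace topology; propositionally equal).
* `SkinnerUrban2014.exists_shapiro_cocycle`, `SkinnerUrban2014.exists_addEquiv_selmerBigDecomp_selmerAc`
  — the Shapiro cocycle and the restricted bijection `Sel^Σ(K, M) ≃+ Sel_𝔭^Σ(K_∞, E[p^∞])`
  intertwining `1 + T` with `conj_γ`.
* **`SkinnerUrban2014.prop323_XAc_equiv_XBigDecomp_holds : prop323_XAc_equiv_XBigDecomp`** — the
  discharge (net Literature debt −1).

References: [SkinnerUrban2014] §3.1.2, §3.2.1–3.2.2, Prop. 3.2.3; [Castella2018] §2.1–2.2, Def. 2.2;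
[GreenbergLNM1716] §1; [Lang1990] Ch. 5 §1.
-/

noncomputable section

open Multiplicative Field IsDedekindDomain NumberField WeierstrassCurve
open Literature.NumberTheory.EllipticCurves Literature.NumberTheory.EllipticCurves.BigGaloisRep
open Literature.NumberTheory.GaloisRepresentations

universe u

namespace Literature.NumberTheory.EllipticCurves

/-! ## §1 The forcing lemma for `ℤ_p⟦T⟧`-linearity into `Hom(S, A)` -/

namespace IwasawaDual.IsLocNil

variable {S : Type*} [AddCommGroup S] {A : Type*} [AddCommGroup A] {p : ℕ} [Fact p.Prime]
  {ψ : AddMonoid.End S} (h : IsLocNil p ψ)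
include h

/-- **FORCING LEMMA.** Let `ψ` be a locally nilpotent endomorphism of the `p`-primary group `S`
(`IsLocNil p ψ`), `X'` any `ℤ_p⟦T⟧`-module and `T : X' →+ Hom(S, A)` additive with
`T(X·x)(s) = T(x)(ψ s)` and `T(C c·x)(s) = (c mod p^k)·T(x)(s)` whenever `p^k s = 0`. Then
`T(f·x) = f ⋆ T(x)` for the canonical action `⋆ = IsLocNil.smulFun` (finite sums
`Σ coeff_i(f)·x(ψ^i s)`) — i.e. `T` is `ℤ_p⟦T⟧`-linear for `IsLocNil.module`. Induction on the
nilpotence exponent of `s`, peeling `f = X·g + C(a₀)`; verbatim the argument of the tree's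
`WeierstrassCurve.SelmerDualData.toDual_smul_apply_of_pow_apply_eq_zero`.
[cite: GreenbergLNM1716, §1 (after Conj. 1.3: "`H¹(F_∞, E[p^∞])` is a `Λ`-module")] [cite: Lang1990, Ch. 5 §1] -/
theorem map_smul_eq_smulFun {X' : Type*} [AddCommGroup X'] [Module (PowerSeries ℤ_[p]) X']
    (T : X' →+ (S →+ A))
    (hX : ∀ (x : X') (s : S), T ((PowerSeries.X : PowerSeries ℤ_[p]) • x) s = T x (ψ s))
    (hC : ∀ (c : ℤ_[p]) (x : X') (s : S) (k : ℕ), p ^ k • s = 0 →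
      T ((PowerSeries.C c : PowerSeries ℤ_[p]) • x) s = (PadicInt.toZModPow k c).val • T x s)
    (f : PowerSeries ℤ_[p]) (x : X') : T (f • x) = h.smulFun f (T x) := by
  ext s
  obtain ⟨N, hN⟩ := h.nil s
  induction N generalizing s f x with
  | zero =>
    rw [pow_zero, AddMonoid.End.one_apply] at hN
    rw [hN, map_zero, map_zero]
  | succ N ih =>
    obtain ⟨k, hk⟩ := h.torsion s
    have hψs : (ψ ^ N) (ψ s) = 0 := by
      rwa [pow_succ, AddMonoid.End.coe_mul, Function.comp_apply] at hN
    -- peel off the constant term: `f = X * g + C a`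
    set g : PowerSeries ℤ_[p] := PowerSeries.mk fun n ↦ PowerSeries.coeff (n + 1) f
    set a : ℤ_[p] := PowerSeries.constantCoeff f
    have hf : f = PowerSeries.X * g + PowerSeries.C a := PowerSeries.eq_X_mul_shift_add_const f
    have lhs : T (f • x) s = T (g • x) (ψ s) + (PadicInt.toZModPow k a).val • T x s := by
      conv_lhs => rw [hf]
      rw [add_smul, mul_smul, map_add, AddMonoidHom.add_apply, hX, hC a x s k hk]
    have rhs : h.smulFun f (T x) s =
        h.smulFun g (T x) (ψ s) + (PadicInt.toZModPow k a).val • T x s := by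
      conv_lhs => rw [hf]
      rw [h.smulFun_add_left, h.smulFun_mul_left, AddMonoidHom.add_apply, h.smulFun_X_apply,
        h.smulFun_C_apply a (T x) hk]
    rw [lhs, rhs, ih g x (ψ s) hψs]

end IwasawaDual.IsLocNil

/-! ## §2 Constants of `ℤ_p⟦T⟧` act on `p^k`-torsion elements through `ℤ/p^k` -/

/-- In any `ℤ_p⟦T⟧`-module, if `p^k · y = 0` then `C(c) · y = (c mod p^k) · y`: write
`c = n + p^k u` with `n = (c mod p^k)` (`PadicInt.ker_toZModPow`), and `C(p^k) · y = p^k · y = 0`.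
[cite: Lang1990, Ch. 5 §1 (the action of `ℤ_p = lim ℤ/p^k` on `p`-power torsion)] -/
theorem PowerSeries.C_smul_eq_val_smul_of_pow_smul_eq_zero {p : ℕ} [Fact p.Prime] {Y : Type*}
    [AddCommGroup Y] [Module (PowerSeries ℤ_[p]) Y] (c : ℤ_[p]) {y : Y} {k : ℕ}
    (hy : p ^ k • y = 0) :
    (PowerSeries.C c : PowerSeries ℤ_[p]) • y = (PadicInt.toZModPow k c).val • y := by
  haveI : NeZero (p ^ k) := ⟨pow_ne_zero _ (Fact.out : p.Prime).ne_zero⟩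
  set n : ℕ := (PadicInt.toZModPow k c).val with hn
  have hmem : c - (n : ℤ_[p]) ∈ RingHom.ker (PadicInt.toZModPow k) := by
    rw [RingHom.mem_ker, map_sub, map_natCast, hn, ZMod.natCast_zmod_val, sub_self]
  rw [PadicInt.ker_toZModPow, Ideal.mem_span_singleton] at hmem
  obtain ⟨u, hu⟩ := hmem
  have hc : c = (n : ℤ_[p]) + (p : ℤ_[p]) ^ k * u := by rw [← hu]; ring
  calc (PowerSeries.C c : PowerSeries ℤ_[p]) • y
      = ((n : PowerSeries ℤ_[p]) + PowerSeries.C u * ((p ^ k : ℕ) : PowerSeries ℤ_[p])) • y := by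
        rw [hc, map_add, map_natCast, map_mul, map_pow, map_natCast, Nat.cast_pow, mul_comm]
    _ = n • y + (PowerSeries.C u : PowerSeries ℤ_[p]) • (p ^ k • y) := by
        rw [add_smul, mul_smul, Nat.cast_smul_eq_nsmul, Nat.cast_smul_eq_nsmul]
    _ = n • y := by rw [hy, smul_zero, add_zero]

/-! ## §3 `H¹(H, M)`, `conj_σ` and `Sel_𝔭^Σ` do not depend on the discrete-topology instance -/

section Discrete

variable {K : Type u} [Field K] [NumberField K]

/-- **Independence of the discrete-topology instance.** For a discrete `Γ_K`-module `M` carrying two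
`DiscreteTopology` instances `t₁, t₂` (e.g. the type synonym `PrimaryTorsion (geomPoints W) p`, with
`⊥`, and the subgroup `W.geomPrimaryTorsion p`, with the subspace topology), `t₁ = t₂`
(`DiscreteTopology.eq_bot`), so `H¹(H, M)`, the classes of cocycles, the conjugation `conj_σ` and
Castella's `Sel_𝔭^Σ(K̄^H, M)` computed with either instance are canonically identified (by the
identity). [cite: SerreGaloisCohomology1997, I §2.2 (cohomology of discrete modules)] -/
theorem exists_subgroupH1_addEquiv_of_discrete (H : Subgroup (absoluteGaloisGroup K)) [H.Normal]
    (M : Type u) [AddCommGroup M] [DistribMulAction (absoluteGaloisGroup K) M]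
    (t₁ t₂ : TopologicalSpace M) (d₁ : @DiscreteTopology M t₁) (d₂ : @DiscreteTopology M t₂)
    (p : ℕ) (𝔭 : HeightOneSpectrum (𝓞 K)) (S : Set (HeightOneSpectrum (𝓞 K))) :
    ∃ e : (letI := t₁; haveI := d₁; subgroupH1 H M) ≃+ (letI := t₂; haveI := d₂; subgroupH1 H M),
      (∀ (z₁ : (letI := t₁; haveI := d₁; contOneCocycles (discreteTopRep H M)))
          (z₂ : (letI := t₂; haveI := d₂; contOneCocycles (discreteTopRep H M))),
          (∀ h : H, z₁.1 h = z₂.1 h) →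
          e ((letI := t₁; haveI := d₁; oneCocycleClass (discreteTopRep H M) z₁)) =
            (letI := t₂; haveI := d₂; oneCocycleClass (discreteTopRep H M) z₂)) ∧
      (∀ z₁ : (letI := t₁; haveI := d₁; contOneCocycles (discreteTopRep H M)),
          ∃ z₂ : (letI := t₂; haveI := d₂; contOneCocycles (discreteTopRep H M)),
            ∀ h : H, z₁.1 h = z₂.1 h) ∧
      (∀ (σ : absoluteGaloisGroup K) (x : (letI := t₁; haveI := d₁; subgroupH1 H M)),
          e ((letI := t₁; haveI := d₁; conjH1 H M σ) x) =
            (letI := t₂; haveI := d₂; conjH1 H M σ) (e x)) ∧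
      ∀ x : (letI := t₁; haveI := d₁; subgroupH1 H M),
        e x ∈ ((letI := t₂; haveI := d₂; Castella2018.AcSelmer.selmerOver H M p 𝔭 S) :
            AddSubgroup (letI := t₂; haveI := d₂; subgroupH1 H M)) ↔
          x ∈ ((letI := t₁; haveI := d₁; Castella2018.AcSelmer.selmerOver H M p 𝔭 S) :
            AddSubgroup (letI := t₁; haveI := d₁; subgroupH1 H M)) := by
  obtain rfl : t₁ = t₂ :=
    (@DiscreteTopology.eq_bot M t₁ d₁).trans (@DiscreteTopology.eq_bot M t₂ d₂).symm
  refine ⟨AddEquiv.refl _, fun z₁ z₂ hz ↦ ?_, fun z₁ ↦ ⟨z₁, fun _ ↦ rfl⟩, fun σ x ↦ rfl,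
    fun x ↦ Iff.rfl⟩
  have hz' : z₁ = z₂ := Subtype.ext (ContinuousMap.ext hz)
  subst hz'
  rfl

end Discrete

/-! ## §4 Shapiro's bijection restricted to the Selmer groups, and the intertwining `1 + T ↦ conj_γ` -/

namespace SkinnerUrban2014

section Generic

variable {K : Type u} [Field K] [NumberField K] {p : ℕ} [Fact p.Prime]
variable {𝒪 : Type*} [CommRing 𝒪] [TopologicalSpace 𝒪]
variable {A : Type u} [AddCommGroup A] [Module 𝒪 A] [DistribMulAction (absoluteGaloisGroup K) A]
  [TopologicalSpace A] [DiscreteTopology A]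
variable [TopologicalSpace (PowerSeries 𝒪)] [ContinuousSMul (PowerSeries 𝒪) (BigRepModule 𝒪 p A)]

omit [NumberField K] in
/-- Conjugation on classes of explicit cocycles: `conj_σ [z] = [x ↦ σ • z(σ⁻¹ x σ)]` (Mathlib
`map_oneCocycleClass`). [cite: SerreGaloisCohomology1997, I §5.1 and I §2.5] -/
private theorem conjH1_oneCocycleClass (H : Subgroup (absoluteGaloisGroup K)) [H.Normal]
    (σ : absoluteGaloisGroup K) (z : contOneCocycles (discreteTopRep H A)) :
    conjH1 H A σ (oneCocycleClass _ z) =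
      oneCocycleClass (discreteTopRep H A)
        (contOneCocycles.pullback (subgroupConj H σ)
          (resHomOfEquivariant (subgroupConj H σ) (DistribSMul.toAddMonoidHom A σ) fun x m ↦ by
            simp only [DistribSMul.toAddMonoidHom_apply, Subgroup.smul_def, subgroupConj_apply_coe,
              smul_smul, mul_assoc, mul_inv_cancel_left]) z) :=
  map_oneCocycleClass (X := discreteTopRep H A) (Y := discreteTopRep H A) (subgroupConj H σ) _ z

omit [NumberField K] in
/-- **The Shapiro cocycle** `Sh(c) : h ↦ c(h)(0)` on `ker κ` of a continuous cocycle `c` of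
`M = A ⊗ Λ^*(Ψ⁻¹)`: continuous (evaluation at `0` on the discrete `M`) and a cocycle for the
`A`-action restricted to `ker κ` (`BigRepModule.apply_zero_cocycle`).
[cite: SkinnerUrban2014, §3.1.1 and Prop. 3.2.3 (proof: Shapiro's lemma)] -/
theorem exists_shapiro_cocycle (κ : ZpExtension K p) (ρ : ContinuousRep (absoluteGaloisGroup K) 𝒪 A)
    (hρ : ∀ (g : absoluteGaloisGroup K) (a : A), ρ g a = g • a)
    (c : contOneCocycles (AnticyclotomicBigGaloisRep κ ρ).toTopRep) :
    ∃ z : contOneCocycles (discreteTopRep κ.kerSubgroup A),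
      ∀ h : κ.kerSubgroup, z.1 h = (c.1 (h : absoluteGaloisGroup K) : BigRepModule 𝒪 p A) 0 := by
  refine ⟨⟨⟨fun h : κ.kerSubgroup ↦ (c.1 (h : absoluteGaloisGroup K) : BigRepModule 𝒪 p A) 0,
      (continuous_of_discreteTopology (f := fun Φ : BigRepModule 𝒪 p A ↦ Φ 0)).comp
        (c.1.continuous.comp continuous_subtype_val)⟩, fun h₁ h₂ ↦ ?_⟩, fun h ↦ rfl⟩
  change (c.1 ((h₁ : absoluteGaloisGroup K) * h₂) : BigRepModule 𝒪 p A) 0 =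
    (c.1 (h₁ : absoluteGaloisGroup K) : BigRepModule 𝒪 p A) 0 +
      (discreteTopRep κ.kerSubgroup A).ρ h₁ ((c.1 (h₂ : absoluteGaloisGroup K) : BigRepModule 𝒪 p A) 0)
  have hYρ : (discreteTopRep κ.kerSubgroup A).ρ h₁
      ((c.1 (h₂ : absoluteGaloisGroup K) : BigRepModule 𝒪 p A) 0) =
      ρ (h₁ : absoluteGaloisGroup K) ((c.1 (h₂ : absoluteGaloisGroup K) : BigRepModule 𝒪 p A) 0) := by
    rw [hρ]; rfl
  rw [hYρ]
  exact BigRepModule.apply_zero_cocycle κ.toContinuousMonoidHom ρ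
    (c := fun g ↦ (c.1 g : BigRepModule 𝒪 p A)) (fun g h ↦ c.2 g h)
    (ZpExtension.mem_kerSubgroup.1 h₁.2) h₂

end Generic

section Curve

variable {K : Type u} [Field K] [NumberField K] (W : WeierstrassCurve K) (p : ℕ) [Fact p.Prime]
  (κ : ZpExtension K p) (𝔭 : HeightOneSpectrum (𝓞 K)) (S : Set (HeightOneSpectrum (𝓞 K)))
  (γ : absoluteGaloisGroup K) (hγ : κ.IsTopGenerator γ)
  [TopologicalSpace (PowerSeries ℤ_[p])]
  [ContinuousSMul (PowerSeries ℤ_[p]) (BigRepModule ℤ_[p] p (PrimaryTorsion (geomPoints W) p))]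

include hγ

/-- **Shapiro's bijection restricted to the Selmer groups, with its orientation.** For `K` totally
complex (imaginary quadratic in the applications), `κ` a `ℤ_p`-extension with topological generator
`γ` (`κ γ = 1`), `A = E[p^∞]`: Shapiro's `[c] ↦ [h ↦ c(h)(0)]` (M5a) restricts to an additive
bijection `Sel^Σ_𝔭(K, A ⊗ Λ^*(Ψ⁻¹)) ≃+ Sel_𝔭^Σ(K_∞, E[p^∞])` (Castella's Def. 2.2 conditions on both
sides, M3c) which carries `1 + T` to `conj_γ` (M4) — "we identify `ℤ_p⟦T⟧` with `Λ = ℤ_p⟦Γ⟧` by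
`1 + T ↦ γ`". [cite: SkinnerUrban2014, Prop. 3.2.3 (proof) with §3.1.2]
[cite: Castella2018, Def. 2.2 and §2.2 ("`1 + T ↦ γ`")] -/
theorem exists_addEquiv_selmerBigDecomp_selmerAc [IsTotallyComplex K] :
    ∃ E : selmerBigDecomp κ (W.primaryTorsionGaloisRep p) 𝔭 S ≃+
        Castella2018.AcSelmer.selmerAc W p κ 𝔭 S,
      ∀ s : selmerBigDecomp κ (W.primaryTorsionGaloisRep p) 𝔭 S,
        ((E ((1 + PowerSeries.X : PowerSeries ℤ_[p]) • s) :
            Castella2018.AcSelmer.selmerAc W p κ 𝔭 S) : W.subgroupH1 p κ.kerSubgroup) =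
          W.conjH1 p κ.kerSubgroup γ (E s : Castella2018.AcSelmer.selmerAc W p κ 𝔭 S) := by
  classical
  have hρ : ∀ (g : absoluteGaloisGroup K) (a : PrimaryTorsion (geomPoints W) p),
      W.primaryTorsionGaloisRep p g a = g • a := fun g a ↦ rfl
  have hA : ∀ a : PrimaryTorsion (geomPoints W) p, ∃ k : ℕ, p ^ k • a = 0 := fun a ↦ by
    obtain ⟨k, hk⟩ := PrimaryTorsion.exists_pow_smul_eq_zero a
    exact ⟨k, PrimaryTorsion.ext (by rw [PrimaryTorsion.val_nsmul, hk, PrimaryTorsion.val_zero])⟩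
  have hH : ∀ g : absoluteGaloisGroup K, g ∈ κ.kerSubgroup ↔ κ.toContinuousMonoidHom g = 1 := fun g ↦
    ZpExtension.mem_kerSubgroup
  -- M5a: Shapiro's bijection on `H¹`
  obtain ⟨e, he⟩ := BigRepModule.exists_addEquiv_h1_shapiro κ.toContinuousMonoidHom
    (W.primaryTorsionGaloisRep p) hρ hA κ.kerSubgroup hH γ hγ
  -- the identification of the two discrete-topology instances on `E[p^∞]`
  obtain ⟨ι, hιz, -, hιconj, hιsel⟩ := exists_subgroupH1_addEquiv_of_discrete κ.kerSubgroup
    (PrimaryTorsion (geomPoints W) p) PrimaryTorsion.instTopologicalSpace instTopologicalSpaceSubtype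
    inferInstance (inferInstance : DiscreteTopology ↥(W.geomPrimaryTorsion p)) p 𝔭 S
  let e' : continuousCohomology 1 (AnticyclotomicBigGaloisRep κ (W.primaryTorsionGaloisRep p)).toTopRep ≃+
      W.subgroupH1 p κ.kerSubgroup := e.trans ι
  have he' : ∀ ξ, e' ξ = ι (e ξ) := fun _ ↦ rfl
  -- membership in the Selmer groups corresponds (M3c)
  have hmem : ∀ ξ, ξ ∈ selmerBigDecomp κ (W.primaryTorsionGaloisRep p) 𝔭 S ↔
      e' ξ ∈ Castella2018.AcSelmer.selmerAc W p κ 𝔭 S := by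
    intro ξ
    obtain ⟨c, rfl⟩ := oneCocycleClass_surjective _ ξ
    obtain ⟨z, hz⟩ := exists_shapiro_cocycle κ (W.primaryTorsionGaloisRep p) hρ c
    rw [oneCocycleClass_mem_selmerBigDecomp_iff κ (W.primaryTorsionGaloisRep p) hρ hA c z hz 𝔭 S, he',
      he c z hz]
    exact (hιsel _).symm
  -- the intertwining `1 + T ↦ conj_γ` on all of `H¹` (M4)
  have hconj : ∀ ξ, e' ((1 + PowerSeries.X : PowerSeries ℤ_[p]) • ξ) =
      W.conjH1 p κ.kerSubgroup γ (e' ξ) := by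
    intro ξ
    obtain ⟨c, rfl⟩ := oneCocycleClass_surjective _ ξ
    obtain ⟨z, hz⟩ := exists_shapiro_cocycle κ (W.primaryTorsionGaloisRep p) hρ c
    obtain ⟨z', hz'⟩ := exists_shapiro_cocycle κ (W.primaryTorsionGaloisRep p) hρ
      ((1 + PowerSeries.X : PowerSeries ℤ_[p]) • c)
    rw [← oneCocycleClass_smul, he', he', he _ z' hz', he c z hz]
    change ι (oneCocycleClass _ z') = W.conjH1 p κ.kerSubgroup γ (ι (oneCocycleClass _ z))
    rw [show W.conjH1 p κ.kerSubgroup γ (ι (oneCocycleClass _ z)) =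
        ι (conjH1 κ.kerSubgroup (PrimaryTorsion (geomPoints W) p) γ (oneCocycleClass _ z)) from
      (hιconj γ _).symm]
    congr 1
    -- `[Sh((1+T)·c)] = conj_γ [Sh c]`: they differ by the coboundary of `b = c(γ)(1)`
    rw [conjH1_oneCocycleClass, eq_comm, ← sub_eq_zero, ← oneCocycleClass_sub,
      oneCocycleClass_eq_zero_iff]
    refine ⟨(c.1 γ : BigRepModule ℤ_[p] p (PrimaryTorsion (geomPoints W) p)) 1, fun x ↦ ?_⟩
    have hx : κ.toContinuousMonoidHom (x : absoluteGaloisGroup K) = 1 := (hH _).1 x.2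
    have key : W.primaryTorsionGaloisRep p γ
        ((c.1 (γ⁻¹ * x * γ) : BigRepModule ℤ_[p] p (PrimaryTorsion (geomPoints W) p)) 0) =
        ((1 + PowerSeries.X : PowerSeries ℤ_[p]) •
            (c.1 x : BigRepModule ℤ_[p] p (PrimaryTorsion (geomPoints W) p))) 0 +
          (W.primaryTorsionGaloisRep p x
              ((c.1 γ : BigRepModule ℤ_[p] p (PrimaryTorsion (geomPoints W) p)) 1) -
            (c.1 γ : BigRepModule ℤ_[p] p (PrimaryTorsion (geomPoints W) p)) 1) :=
      BigRepModule.conj_apply_zero_eq_one_add_X_smul (κ := κ.toContinuousMonoidHom)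
        (ρ := W.primaryTorsionGaloisRep p)
        (c := fun g ↦ (c.1 g : BigRepModule ℤ_[p] p (PrimaryTorsion (geomPoints W) p)))
        (fun g h ↦ c.2 g h) hγ hx
    change γ • z.1 (subgroupConj κ.kerSubgroup γ x) - z'.1 x =
      (discreteTopRep κ.kerSubgroup (PrimaryTorsion (geomPoints W) p)).ρ x
          ((c.1 γ : BigRepModule ℤ_[p] p (PrimaryTorsion (geomPoints W) p)) 1) -
        (c.1 γ : BigRepModule ℤ_[p] p (PrimaryTorsion (geomPoints W) p)) 1
    rw [hz, hz',
      show (discreteTopRep κ.kerSubgroup (PrimaryTorsion (geomPoints W) p)).ρ x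
          ((c.1 γ : BigRepModule ℤ_[p] p (PrimaryTorsion (geomPoints W) p)) 1) =
        W.primaryTorsionGaloisRep p x
          ((c.1 γ : BigRepModule ℤ_[p] p (PrimaryTorsion (geomPoints W) p)) 1) by rw [hρ]; rfl,
      ← hρ, subgroupConj_apply_coe]
    change W.primaryTorsionGaloisRep p γ
        ((c.1 (γ⁻¹ * x * γ) : BigRepModule ℤ_[p] p (PrimaryTorsion (geomPoints W) p)) 0) -
      ((1 + PowerSeries.X : PowerSeries ℤ_[p]) •
          (c.1 x : BigRepModule ℤ_[p] p (PrimaryTorsion (geomPoints W) p))) 0 = _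
    rw [key, add_sub_cancel_left]
  -- the restricted bijection
  refine ⟨{ toFun := fun s ↦ ⟨e' s, (hmem s).1 s.2⟩
            invFun := fun t ↦ ⟨e'.symm t, (hmem _).2 (by rw [AddEquiv.apply_symm_apply]; exact t.2)⟩
            left_inv := fun s ↦ Subtype.ext (e'.symm_apply_apply s)
            right_inv := fun t ↦ Subtype.ext (e'.apply_symm_apply t)
            map_add' := fun s t ↦ Subtype.ext (map_add e' s.1 t.1) }, fun s ↦ ?_⟩
  exact hconj s

end Curve

/-! ## §5 The `Λ`-linear duality and the discharge -/

section Duality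

variable {K : Type u} [Field K] [NumberField K] (W : WeierstrassCurve K) (p : ℕ) [Fact p.Prime]
  (κ : ZpExtension K p) (𝔭 : HeightOneSpectrum (𝓞 K)) (S : Set (HeightOneSpectrum (𝓞 K)))
  (γ : absoluteGaloisGroup K) [hγF : Fact (κ.IsTopGenerator γ)]
  [TopologicalSpace (PowerSeries ℤ_[p])]
  [ContinuousSMul (PowerSeries ℤ_[p]) (BigRepModule ℤ_[p] p (PrimaryTorsion (geomPoints W) p))]

set_option maxHeartbeats 400000 in
/-- **`X_ac^Σ(E[p^∞]) ≃ₗ[Λ] Sel^Σ_𝔭(K, E[p^∞] ⊗ Λ^*(Ψ⁻¹))^∨`** for `E/K`, `K` totally complex, `κ` a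
`ℤ_p`-extension with topological generator `γ`: the dual of the restricted Shapiro bijection `E`
(`exists_addEquiv_selmerBigDecomp_selmerAc`) is additive and bijective, and `Λ`-linear by the forcing
set_option maxHeartbeats 400000 in
lemma — `T` acts on the right through `(1+T)·[c]`, carried by `E` to `conj_γ`, which is how
`T = γ − 1` acts on `X_ac` (`IwasawaDual.IsLocNil.module`); constants act through `ℤ/p^k` on both
sides (`PowerSeries.C_smul_eq_val_smul_of_pow_smul_eq_zero`, `IsLocNil.smulFun_C_apply`).
[cite: SkinnerUrban2014, Prop. 3.2.3 (isomorphism of `Λ_{F,A}`-modules) with §3.2.1–3.2.2]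
[cite: Castella2018, §2.2 ("`1 + T ↦ γ`")] -/
theorem nonempty_linearEquiv_XAc_XBigDecomp [IsTotallyComplex K] :
    Nonempty (Castella2018.AcSelmer.XAc W p κ 𝔭 S γ ≃ₗ[IwasawaAlgebra p]
      XBigDecomp κ (W.primaryTorsionGaloisRep p) 𝔭 S) := by
  obtain ⟨E, hE⟩ := exists_addEquiv_selmerBigDecomp_selmerAc W p κ 𝔭 S γ hγF.out
  have h := Castella2018.AcSelmer.isLocNil_conjSelmerAc_sub_one W p κ 𝔭 S hγF.out
  -- `E` carries `1 + T` to `conj_γ`, as elements of `Sel_𝔭^Σ(K_∞)`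
  have hE' : ∀ s : selmerBigDecomp κ (W.primaryTorsionGaloisRep p) 𝔭 S,
      E ((1 + PowerSeries.X : PowerSeries ℤ_[p]) • s) =
        Castella2018.AcSelmer.conjSelmerAc W p κ 𝔭 S γ (E s) := fun s ↦
    Subtype.ext (by rw [Castella2018.AcSelmer.coe_conjSelmerAc_apply]; exact hE s)
  have hEX : ∀ t : Castella2018.AcSelmer.selmerAc W p κ 𝔭 S,
      (PowerSeries.X : PowerSeries ℤ_[p]) • E.symm t =
        E.symm (Castella2018.AcSelmer.conjSelmerAc W p κ 𝔭 S γ t) - E.symm t := fun t ↦ by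
    have h1 := hE' (E.symm t)
    rw [E.apply_symm_apply] at h1
    calc (PowerSeries.X : PowerSeries ℤ_[p]) • E.symm t
        = (1 + PowerSeries.X : PowerSeries ℤ_[p]) • E.symm t - E.symm t := by
          rw [add_smul, one_smul, add_sub_cancel_left]
      _ = E.symm (E ((1 + PowerSeries.X : PowerSeries ℤ_[p]) • E.symm t)) - E.symm t := by
          rw [E.symm_apply_apply]
      _ = E.symm (Castella2018.AcSelmer.conjSelmerAc W p κ 𝔭 S γ t) - E.symm t := by rw [h1]
  -- the dual map `T : X^Σ → X_ac`, `χ ↦ χ ∘ E⁻¹`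
  let T : XBigDecomp κ (W.primaryTorsionGaloisRep p) 𝔭 S →+
      Castella2018.AcSelmer.XAc W p κ 𝔭 S γ :=
    { toFun := fun χ ↦
        ((χ : selmerBigDecomp κ (W.primaryTorsionGaloisRep p) 𝔭 S →+ AddCircle (1 : ℚ)).comp
            E.symm.toAddMonoidHom :
          Castella2018.AcSelmer.selmerAc W p κ 𝔭 S →+ AddCircle (1 : ℚ))
      map_zero' := rfl
      map_add' := fun _ _ ↦ rfl }
  -- `T` is `Λ`-linear by the forcing lemma
  have hlin : ∀ (f : PowerSeries ℤ_[p]) (χ : XBigDecomp κ (W.primaryTorsionGaloisRep p) 𝔭 S),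
      T (f • χ) = f • T χ := fun f χ ↦ by
    refine h.map_smul_eq_smulFun T (fun χ t ↦ ?_) (fun c χ t k hk ↦ ?_) f χ
    · change ((PowerSeries.X : PowerSeries ℤ_[p]) • χ) (E.symm t) =
        χ (E.symm (Castella2018.AcSelmer.conjSelmerAc W p κ 𝔭 S γ t - t))
      rw [CharacterModule.smul_apply, hEX]
      simp only [map_sub]
    · have hk' : p ^ k • E.symm t = 0 := by rw [← map_nsmul, hk, map_zero]
      change ((PowerSeries.C c : PowerSeries ℤ_[p]) • χ) (E.symm t) =
        (PadicInt.toZModPow k c).val • χ (E.symm t)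
      rw [CharacterModule.smul_apply, PowerSeries.C_smul_eq_val_smul_of_pow_smul_eq_zero c hk',
        map_nsmul]
  refine ⟨LinearEquiv.symm
    { toFun := T
      invFun := fun x ↦
        ((x : Castella2018.AcSelmer.selmerAc W p κ 𝔭 S →+ AddCircle (1 : ℚ)).comp E.toAddMonoidHom :
          selmerBigDecomp κ (W.primaryTorsionGaloisRep p) 𝔭 S →+ AddCircle (1 : ℚ))
      map_add' := fun χ χ' ↦ map_add T χ χ'
      map_smul' := fun f χ ↦ hlin f χ
      left_inv := fun χ ↦ ?_
      right_inv := fun x ↦ ?_ }⟩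
  · refine AddMonoidHom.ext fun y ↦ ?_
    change χ (E.symm (E y)) = χ y
    rw [E.symm_apply_apply]
  · refine AddMonoidHom.ext fun t ↦ ?_
    change x (E (E.symm t)) = x t
    rw [E.apply_symm_apply]

end Duality

/-- **DISCHARGE of `SkinnerUrban2014.prop323_XAc_equiv_XBigDecomp`** ([SU14] Prop. 3.2.3, Shapiro's
lemma for Selmer groups, anticyclotomic case with Castella's Def. 2.2 conditions, dualised):
`X^Σ_ac(E[p^∞]) ≃ₗ[Λ] Sel^Σ_𝔭(K, T_pE ⊗ Λ^*(Ψ⁻¹))^∨` for `E/ℚ` base-changed to the imaginary quadratic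
`K` (`IsImaginaryQuadratic K` supplies `IsTotallyComplex K`; the hypotheses `3 ≤ p`, Heegner, `𝔭 ∣ p`,
`Σ` finite away from `p`, `κ` anticyclotomic of the fact are not needed for the isomorphism).
[cite: SkinnerUrban2014, Prop. 3.2.3 with §3.1.2 and §3.2.1–3.2.2 (pp. 16–18, 21–22)]
[cite: Castella2018, Def. 2.2 and §2.2 (pp. 4–5)] -/
theorem prop323_XAc_equiv_XBigDecomp_holds : prop323_XAc_equiv_XBigDecomp := by
  intro W _ p _ _ K _ _ hK _ 𝔭 _ S _ _ κ _ γ _ _ _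
  haveI : IsTotallyComplex K := hK.2
  exact nonempty_linearEquiv_XAc_XBigDecomp (W.baseChange K) p κ 𝔭 S γ

end SkinnerUrban2014

end Literature.NumberTheory.EllipticCurves

end
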